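import Mathlib
import Literature.Computability.AlgebraicComplexity.OrbitCoordinateRing
import Literature.NumberTheory.DiophantineGeometry.GLHighestWeight
import Literature.NumberTheory.DiophantineGeometry.TensorWordModel

/-!
# Products of highest-weight vectors in an orbit-closure coordinate ring (`stub_hwvMul`)

In the coordinate ring `ℂ[Δ_m(f)] = OrbitCoordRing f m` of the orbit closure of any form `f`, the
group `GL σ ℂ` acts through algebra endomorphisms (`orbitCoordRep_apply`,
`orbitCoordSubst f m g : OrbitCoordRing f m →ₐ[ℂ] OrbitCoordRing f m`), so for `B`-semi-invariants
`x, y` of weights `χ₁, χ₂` and every upper triangular `g`: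
`g · (x y) = (g · x)(g · y) = χ₁(g) χ₂(g) · x y = (χ₁ + χ₂)(g) · x y` (`weightChar_add`, the diagonal
of an upper triangular invertible `g` being nonzero).  Hence highest-weight vectors are closed under
multiplication, with weights adding.
-/

set_option linter.dupNamespace false

namespace Summit.ValiantsHypothesis.ValiantsHypothesis.Theorems.ValuativeFlip

noncomputable section

open Literature.NumberTheory.DiophantineGeometry Literature.Computability.AlgebraicComplexity

/-- **Multiplicativity of highest-weight vectors.**  In the coordinate ring
`ℂ[Δ_m(f)] = OrbitCoordRing f m` of the orbit closure of any form `f`, on which `GL σ ℂ` acts by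
algebra endomorphisms (`orbitCoordRep`), the product of highest-weight vectors of weights `χ₁` and
`χ₂` is a highest-weight vector of weight `χ₁ + χ₂`. -/
theorem stub_hwvMul :
    ∀ {σ : Type} [Fintype σ] [LinearOrder σ] (f : MvPolynomial σ ℂ) (m : ℕ) (χ₁ χ₂ : Weight σ)
      (x y : OrbitCoordRing f m),
      x ∈ highestWeightSpace (orbitCoordRep f m) χ₁ → y ∈ highestWeightSpace (orbitCoordRep f m) χ₂ →
      x * y ∈ highestWeightSpace (orbitCoordRep f m) (χ₁ + χ₂) := by
  intro σ _ _ f m χ₁ χ₂ x y hx hy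
  rw [mem_highestWeightSpace_iff] at hx hy ⊢
  intro g hg
  rw [orbitCoordRep_apply, map_mul, ← orbitCoordRep_apply, ← orbitCoordRep_apply, hx g hg, hy g hg,
    weightChar_add χ₁ χ₂ hg, smul_mul_smul_comm]

end

end Summit.ValiantsHypothesis.ValiantsHypothesis.Theorems.ValuativeFlip
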